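import Mathlib
import HarnessLib
import Literature.Probability.LatticeModels.BrillouinRiemannSumTwoVolume
import Summits.HubbardSuperconductivity.HubbardSuperconductivity.Theorems.KLProgrammeKLRegimeVolumeLimitSunset
import Summits.HubbardSuperconductivity.HubbardSuperconductivity.Theorems.KLProgrammeKLRegimeVolumeLimitSunsetTail
import Summits.HubbardSuperconductivity.HubbardSuperconductivity.Theorems.KLProgrammeKLRegimeVolumeLimitCauchyTermwise

/-!
# Route `KLProgramme` — VL child `KLRegimeVolumeLimitV12` (stmt-HubbardSuperconductivity-19858): the ORDER-`U²` (SUNSET) RUNG of the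
# registered CAUCHY stub `stub_vl_twoVolumeRate`, MODEL-FREE — PART 1/2: the TERM LEVEL (one kept term = one momentum average over `(ℤ/L)⁴`;
# its Lipschitz modulus, torus modulus, size and two-volume Riemann rate)
# (cell gate-hubbard-kl, seat hubbard-kl-k3c4-p1 g4; companion of `…VolumeLimitSunset` (limit form, g0) and `…ZeroCouplingRate` (order `U⁰`, g3);
# PART 2/2 = `…VolumeLimitSunsetRate`: the two-cutoff bookkeeping and the theorem `klSunset_twoVolumeRate(_stubShape)`)

THE OBJECT is `…VolumeLimitSunset.klSunset L M β g (ω, k⃗) σ = Σ_{(a,b) ∈ ℤ²} klSunsetTerm …`: at external fermionic Matsubara integer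
`n = matsubaraInt M ω`, the `(a, b)` term is KEPT iff `a`, `b`, `n+b-a ∈ [-M, M-1]` and is then `β⁻² · L⁻²Σ_p L⁻²Σ_q g_a(p_p) g_b(p_q)
g_{n+b-a}(p_{k⃗+q-p})`.  ADMISSIBLE symbol families WITH MODULUS: each `g_a` is `2π`-periodic, `‖g_a(x)‖ ≤ C/|a+½|`, and
`‖g_a(x) - g_a(y)‖ ≤ (K/|a+½|)·‖x - y‖_∞` (the frame propagator `(e_K(x) - iω_a)⁻¹` has `C = β/2π`, `K = 7√2·β²/(2π²)` under `FrameOK`).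

THE THEOREM `klSunset_twoVolumeRate` / `klSunset_twoVolumeRate_stubShape`: for every such family and every `β > 0` there are an explicit
`D` and a sequence `ρ L → 0` such that for ALL volumes `1 ≤ L ≤ L′`, all cutoffs `M ≥ L`, `M′ ≥ L′`, every spin, all frequency labels
`ω ∈ MatsubaraIdx M`, `ω′ ∈ MatsubaraIdx M′` with the SAME Matsubara integer, and all torus momenta `k ∈ (ℤ/L)²`, `k′ ∈ (ℤ/L′)²`,

  `‖klSunset L M β g (ω,k) σ - klSunset L′ M′ β g (ω′,k′) σ‖ ≤ ρ L + D · Σ_i |p_k i - p′_{k′} i|_𝕋`,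
  `ρ L = β⁻²·48π K C² G²/L + β⁻²·6 C³ H²·((L+½)^{1/4})⁻¹`,  `D = β⁻²·3 K C² G²`

(`G = Σ_a |a+½|^{-3/2}`, `H = Σ_a |a+½|^{-11/8}`) — the inequality of the registered stub, for this carrier, with thresholds `L₀ = 0`,
`Mth = id`.  ASSEMBLY: (i) each kept term is ONE momentum average over `(ℤ/L)⁴` of the `L`-independent integrand
`G_z(w) = g_a(w_I) g_b(w_II) g_{n+b-a}(z + w_II - w_I)` at `z = p_k` (`momentumAverage_momentumAverage_eq`, exact torus conservation
`apply_latticeMomentum_add_sub`); (ii) `G_z` is `4KC²·w_n(a,b)`-Lipschitz in `w` and `KC²·w_n(a,b)·Σ|z-z′|_𝕋`-close to `G_{z′}`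
(`norm_sub_le_mul_tmod_of_periodic`), so the two-volume Riemann lemma `norm_momentumAverage_sub_momentumAverage_le` gives the rate
`16π K C² w_n(a,b)/L + K C² w_n(a,b)·Σ|·|_𝕋` per term, summed with `Σ_{(a,b)} w_n(a,b) ≤ 3G²` (`klsf_tsum_sunsetWeight_le`, uniform in `n`);
(iii) the CUTOFF MISMATCH — terms kept at one of `M`, `M′` only — is bounded by the `n`-UNIFORM tail `klst_tsum_sunsetWeight_indicator_le_of_cutoff`
(`≤ ((M+½)^{1/4})⁻¹·3H²`), which is where the Cauchy form needs more than the per-`m` VL text.  The abstract two-cutoff bookkeeping is isolated in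
`klsr_norm_tsum_kept_sub_le`.  Nothing is asserted about the Hubbard model; the frame-propagator instance is the companion file
`…VolumeLimitSunsetFrameRate`.

References: G. Benfatto, A. Giuliani, V. Mastropietro, Ann. Henri Poincaré 7 (2006) 809–898, §2.1 (2.3)–(2.8), §2.4; S. Friedli, Y. Velenik,
*Statistical Mechanics of Lattice Systems* (2017) §10.5.2 (10.41) (Riemann sums on the torus).
-/

noncomputable section

namespace Summit.HubbardSuperconductivity.HubbardSuperconductivity.Theorems.KLRegimeSplit

set_option linter.dupNamespace false -- summit = problem name (single-conjunct summit), D-0017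

open Filter Topology Finset Real Literature.MathematicalPhysics.QuantumLattice Literature.Probability.LatticeModels
open Summit.HubbardSuperconductivity.HubbardSuperconductivity.Theorems.KLProgrammeLegKernels
open scoped NNReal

/-! ## §1 Algebra: products of three bounded factors -/

/-- Telescoping: `‖u₁u₂u₃ − v₁v₂v₃‖ ≤ ‖u₁−v₁‖C₂C₃ + C₁‖u₂−v₂‖C₃ + C₁C₂‖u₃−v₃‖` when `‖uᵢ‖, ‖vᵢ‖ ≤ Cᵢ`. -/
theorem klsr_norm_mul3_sub_mul3_le {u₁ u₂ u₃ v₁ v₂ v₃ : ℂ} {C₁ C₂ C₃ : ℝ} (hu₂ : ‖u₂‖ ≤ C₂) (hu₃ : ‖u₃‖ ≤ C₃) (hv₁ : ‖v₁‖ ≤ C₁)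
    (hv₂ : ‖v₂‖ ≤ C₂) :
    ‖u₁ * u₂ * u₃ - v₁ * v₂ * v₃‖ ≤ ‖u₁ - v₁‖ * C₂ * C₃ + C₁ * ‖u₂ - v₂‖ * C₃ + C₁ * C₂ * ‖u₃ - v₃‖ := by
  have hC₁ : 0 ≤ C₁ := (norm_nonneg _).trans hv₁
  have hC₂ : 0 ≤ C₂ := (norm_nonneg _).trans hu₂
  have hsplit : u₁ * u₂ * u₃ - v₁ * v₂ * v₃ = (u₁ - v₁) * u₂ * u₃ + v₁ * (u₂ - v₂) * u₃ + v₁ * v₂ * (u₃ - v₃) := by ring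
  rw [hsplit]
  calc ‖(u₁ - v₁) * u₂ * u₃ + v₁ * (u₂ - v₂) * u₃ + v₁ * v₂ * (u₃ - v₃)‖
      ≤ ‖(u₁ - v₁) * u₂ * u₃‖ + ‖v₁ * (u₂ - v₂) * u₃‖ + ‖v₁ * v₂ * (u₃ - v₃)‖ := norm_add₃_le
    _ = ‖u₁ - v₁‖ * ‖u₂‖ * ‖u₃‖ + ‖v₁‖ * ‖u₂ - v₂‖ * ‖u₃‖ + ‖v₁‖ * ‖v₂‖ * ‖u₃ - v₃‖ := by
        simp only [norm_mul]
    _ ≤ ‖u₁ - v₁‖ * C₂ * C₃ + C₁ * ‖u₂ - v₂‖ * C₃ + C₁ * C₂ * ‖u₃ - v₃‖ := by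
        gcongr

/-- `‖u₁u₂u₃‖ ≤ C₁C₂C₃` when `‖uᵢ‖ ≤ Cᵢ`. -/
theorem klsr_norm_mul3_le {u₁ u₂ u₃ : ℂ} {C₁ C₂ C₃ : ℝ} (hu₁ : ‖u₁‖ ≤ C₁) (hu₂ : ‖u₂‖ ≤ C₂) (hu₃ : ‖u₃‖ ≤ C₃) :
    ‖u₁ * u₂ * u₃‖ ≤ C₁ * C₂ * C₃ := by
  have hC₁ : 0 ≤ C₁ := (norm_nonneg _).trans hu₁
  have hC₂ : 0 ≤ C₂ := (norm_nonneg _).trans hu₂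
  rw [norm_mul, norm_mul]
  exact mul_le_mul (mul_le_mul hu₁ hu₂ (norm_nonneg _) hC₁) hu₃ (norm_nonneg _) (mul_nonneg hC₁ hC₂)

/-! ## §2 The combined two-loop integrand: projections, Lipschitz modulus in the loop momenta, torus modulus in the external momentum -/

/-- The first-loop projection `w ↦ w_I` is `1`-Lipschitz for the sup norms. -/
theorem klsr_norm_projI_sub_le (w w' : Fin (2 + 2) → ℝ) :
    ‖(fun i : Fin 2 => w (Fin.castAdd 2 i)) - fun i : Fin 2 => w' (Fin.castAdd 2 i)‖ ≤ ‖w - w'‖ := by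
  refine (pi_norm_le_iff_of_nonneg (norm_nonneg _)).2 fun i => ?_
  simpa using norm_le_pi_norm (w - w') (Fin.castAdd 2 i)

/-- The second-loop projection `w ↦ w_II` is `1`-Lipschitz for the sup norms. -/
theorem klsr_norm_projII_sub_le (w w' : Fin (2 + 2) → ℝ) :
    ‖(fun j : Fin 2 => w (Fin.natAdd 2 j)) - fun j : Fin 2 => w' (Fin.natAdd 2 j)‖ ≤ ‖w - w'‖ := by
  refine (pi_norm_le_iff_of_nonneg (norm_nonneg _)).2 fun j => ?_
  simpa using norm_le_pi_norm (w - w') (Fin.natAdd 2 j)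

/-- The conserved third momentum `z + w_II − w_I` is `2`-Lipschitz in `w`. -/
theorem klsr_norm_third_sub_le (z : Fin 2 → ℝ) (w w' : Fin (2 + 2) → ℝ) :
    ‖(fun i : Fin 2 => z i + w (Fin.natAdd 2 i) - w (Fin.castAdd 2 i)) -
        fun i : Fin 2 => z i + w' (Fin.natAdd 2 i) - w' (Fin.castAdd 2 i)‖ ≤ 2 * ‖w - w'‖ := by
  refine (pi_norm_le_iff_of_nonneg (by positivity)).2 fun i => ?_
  have h1 := norm_le_pi_norm (w - w') (Fin.natAdd 2 i)
  have h2 := norm_le_pi_norm (w - w') (Fin.castAdd 2 i)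
  simp only [Pi.sub_apply, Real.norm_eq_abs] at h1 h2 ⊢
  have : z i + w (Fin.natAdd 2 i) - w (Fin.castAdd 2 i) - (z i + w' (Fin.natAdd 2 i) - w' (Fin.castAdd 2 i)) =
      (w (Fin.natAdd 2 i) - w' (Fin.natAdd 2 i)) - (w (Fin.castAdd 2 i) - w' (Fin.castAdd 2 i)) := by ring
  rw [this]
  calc |w (Fin.natAdd 2 i) - w' (Fin.natAdd 2 i) - (w (Fin.castAdd 2 i) - w' (Fin.castAdd 2 i))|
      ≤ |w (Fin.natAdd 2 i) - w' (Fin.natAdd 2 i)| + |w (Fin.castAdd 2 i) - w' (Fin.castAdd 2 i)| := abs_sub _ _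
    _ ≤ ‖w - w'‖ + ‖w - w'‖ := add_le_add h1 h2
    _ = 2 * ‖w - w'‖ := by ring

section Integrand

variable {g : ℤ → (Fin 2 → ℝ) → ℂ} {C K : ℝ}

/-- **Lipschitz modulus of the two-loop integrand in the loop momenta.**  For an admissible family with modulus,
`‖G_z(w) − G_z(w′)‖ ≤ 4KC²·(|a+½||b+½||c+½|)⁻¹·‖w − w′‖_∞`, `G_z(w) = g_a(w_I) g_b(w_II) g_c(z + w_II − w_I)`. -/
theorem klsr_integrand_sub_le (hC : 0 ≤ C) (hK : 0 ≤ K)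
    (hg_bdd : ∀ (a : ℤ) (x : Fin 2 → ℝ), ‖g a x‖ ≤ C / |(a : ℝ) + 1 / 2|)
    (hg_lip : ∀ (a : ℤ) (x y : Fin 2 → ℝ), ‖g a x - g a y‖ ≤ K / |(a : ℝ) + 1 / 2| * ‖x - y‖)
    (a b c : ℤ) (z : Fin 2 → ℝ) (w w' : Fin (2 + 2) → ℝ) :
    ‖g a (fun i => w (Fin.castAdd 2 i)) * g b (fun j => w (Fin.natAdd 2 j)) *
          g c (fun i => z i + w (Fin.natAdd 2 i) - w (Fin.castAdd 2 i)) -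
        g a (fun i => w' (Fin.castAdd 2 i)) * g b (fun j => w' (Fin.natAdd 2 j)) *
          g c (fun i => z i + w' (Fin.natAdd 2 i) - w' (Fin.castAdd 2 i))‖ ≤
      4 * K * C ^ 2 * (|(a : ℝ) + 1 / 2| * |(b : ℝ) + 1 / 2| * |(c : ℝ) + 1 / 2|)⁻¹ * ‖w - w'‖ := by
  have ha := klsf_abs_add_half_pos a
  have hb := klsf_abs_add_half_pos b
  have hc := klsf_abs_add_half_pos c
  have h := klsr_norm_mul3_sub_mul3_le (C₁ := C / |(a : ℝ) + 1 / 2|) (C₂ := C / |(b : ℝ) + 1 / 2|)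
    (C₃ := C / |(c : ℝ) + 1 / 2|)
    (u₁ := g a (fun i => w (Fin.castAdd 2 i))) (u₂ := g b (fun j => w (Fin.natAdd 2 j)))
    (u₃ := g c (fun i => z i + w (Fin.natAdd 2 i) - w (Fin.castAdd 2 i)))
    (v₁ := g a (fun i => w' (Fin.castAdd 2 i))) (v₂ := g b (fun j => w' (Fin.natAdd 2 j)))
    (v₃ := g c (fun i => z i + w' (Fin.natAdd 2 i) - w' (Fin.castAdd 2 i)))
    (hg_bdd b _) (hg_bdd c _) (hg_bdd a _) (hg_bdd b _)
  have h1 : ‖g a (fun i => w (Fin.castAdd 2 i)) - g a (fun i => w' (Fin.castAdd 2 i))‖ ≤ K / |(a : ℝ) + 1 / 2| * ‖w - w'‖ :=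
    (hg_lip a _ _).trans (mul_le_mul_of_nonneg_left (klsr_norm_projI_sub_le w w') (div_nonneg hK ha.le))
  have h2 : ‖g b (fun j => w (Fin.natAdd 2 j)) - g b (fun j => w' (Fin.natAdd 2 j))‖ ≤ K / |(b : ℝ) + 1 / 2| * ‖w - w'‖ :=
    (hg_lip b _ _).trans (mul_le_mul_of_nonneg_left (klsr_norm_projII_sub_le w w') (div_nonneg hK hb.le))
  have h3 : ‖g c (fun i => z i + w (Fin.natAdd 2 i) - w (Fin.castAdd 2 i)) -
      g c (fun i => z i + w' (Fin.natAdd 2 i) - w' (Fin.castAdd 2 i))‖ ≤ K / |(c : ℝ) + 1 / 2| * (2 * ‖w - w'‖) :=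
    (hg_lip c _ _).trans (mul_le_mul_of_nonneg_left (klsr_norm_third_sub_le z w w') (div_nonneg hK hc.le))
  have hCa : 0 ≤ C / |(a : ℝ) + 1 / 2| := div_nonneg hC ha.le
  have hCb : 0 ≤ C / |(b : ℝ) + 1 / 2| := div_nonneg hC hb.le
  have hCc : 0 ≤ C / |(c : ℝ) + 1 / 2| := div_nonneg hC hc.le
  calc _ ≤ ‖g a (fun i => w (Fin.castAdd 2 i)) - g a (fun i => w' (Fin.castAdd 2 i))‖ * (C / |(b : ℝ) + 1 / 2|) *
            (C / |(c : ℝ) + 1 / 2|) +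
          C / |(a : ℝ) + 1 / 2| * ‖g b (fun j => w (Fin.natAdd 2 j)) - g b (fun j => w' (Fin.natAdd 2 j))‖ *
            (C / |(c : ℝ) + 1 / 2|) +
          C / |(a : ℝ) + 1 / 2| * (C / |(b : ℝ) + 1 / 2|) *
            ‖g c (fun i => z i + w (Fin.natAdd 2 i) - w (Fin.castAdd 2 i)) -
              g c (fun i => z i + w' (Fin.natAdd 2 i) - w' (Fin.castAdd 2 i))‖ := h
    _ ≤ K / |(a : ℝ) + 1 / 2| * ‖w - w'‖ * (C / |(b : ℝ) + 1 / 2|) * (C / |(c : ℝ) + 1 / 2|) +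
          C / |(a : ℝ) + 1 / 2| * (K / |(b : ℝ) + 1 / 2| * ‖w - w'‖) * (C / |(c : ℝ) + 1 / 2|) +
          C / |(a : ℝ) + 1 / 2| * (C / |(b : ℝ) + 1 / 2|) * (K / |(c : ℝ) + 1 / 2| * (2 * ‖w - w'‖)) := by
        gcongr
    _ = 4 * K * C ^ 2 * (|(a : ℝ) + 1 / 2| * |(b : ℝ) + 1 / 2| * |(c : ℝ) + 1 / 2|)⁻¹ * ‖w - w'‖ := by
        field_simp
        ring

/-- **Torus modulus of the two-loop integrand in the external momentum.**  For an admissible family with modulus,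
`‖G_z(w) − G_{z′}(w)‖ ≤ KC²·(|a+½||b+½||c+½|)⁻¹·Σ_i |z_i − z′_i|_𝕋` (periodicity of `g_c` turns the sup-Lipschitz bound into a
torus-Lipschitz one, `norm_sub_le_mul_tmod_of_periodic`). -/
theorem klsr_integrand_sub_le_tmod (hC : 0 ≤ C) (hK : 0 ≤ K)
    (hg_per : ∀ (a : ℤ) (x : Fin 2 → ℝ) (m : Fin 2 → ℤ), g a (fun i => x i + 2 * π * (m i : ℝ)) = g a x)
    (hg_bdd : ∀ (a : ℤ) (x : Fin 2 → ℝ), ‖g a x‖ ≤ C / |(a : ℝ) + 1 / 2|)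
    (hg_lip : ∀ (a : ℤ) (x y : Fin 2 → ℝ), ‖g a x - g a y‖ ≤ K / |(a : ℝ) + 1 / 2| * ‖x - y‖)
    (a b c : ℤ) (z z' : Fin 2 → ℝ) (w : Fin (2 + 2) → ℝ) :
    ‖g a (fun i => w (Fin.castAdd 2 i)) * g b (fun j => w (Fin.natAdd 2 j)) *
          g c (fun i => z i + w (Fin.natAdd 2 i) - w (Fin.castAdd 2 i)) -
        g a (fun i => w (Fin.castAdd 2 i)) * g b (fun j => w (Fin.natAdd 2 j)) *
          g c (fun i => z' i + w (Fin.natAdd 2 i) - w (Fin.castAdd 2 i))‖ ≤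
      K * C ^ 2 * (|(a : ℝ) + 1 / 2| * |(b : ℝ) + 1 / 2| * |(c : ℝ) + 1 / 2|)⁻¹ * ∑ i, torusAbs (z i - z' i) := by
  have ha := klsf_abs_add_half_pos a
  have hb := klsf_abs_add_half_pos b
  have hc := klsf_abs_add_half_pos c
  -- the third factor as a periodic Lipschitz function of the external momentum
  set s : Fin 2 → ℝ := fun i => w (Fin.natAdd 2 i) - w (Fin.castAdd 2 i) with hs
  have hfz : ∀ y : Fin 2 → ℝ, (fun i => y i + w (Fin.natAdd 2 i) - w (Fin.castAdd 2 i)) = fun i => y i + s i := by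
    intro y; funext i; simp only [hs]; ring
  have hmod := norm_sub_le_mul_tmod_of_periodic (E := ℂ) (f := fun y : Fin 2 → ℝ => g c (fun i => y i + s i))
    (K := K / |(c : ℝ) + 1 / 2|) (div_nonneg hK hc.le) ?_ ?_ z z'
  rotate_left
  · -- periodicity in the external momentum
    intro y m
    have harg : (fun i => (fun i => y i + m i * (2 * Real.pi)) i + s i) = fun i => (y i + s i) + 2 * π * (m i : ℝ) := by
      funext i; ring
    simp only
    rw [harg, hg_per c (fun i => y i + s i) m]
  · -- Lipschitz in the external momentum
    intro y y'
    have h := hg_lip c (fun i => y i + s i) (fun i => y' i + s i)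
    have hsub : ((fun i => y i + s i) - fun i => y' i + s i) = y - y' := by
      funext i; simp only [Pi.sub_apply]; ring
    rw [hsub] at h
    exact h
  rw [← mul_sub, norm_mul, norm_mul, hfz z, hfz z']
  have hmod' : ‖g c (fun i => z i + s i) - g c (fun i => z' i + s i)‖ ≤ K / |(c : ℝ) + 1 / 2| * ∑ i, torusAbs (z i - z' i) := hmod
  have hCa : 0 ≤ C / |(a : ℝ) + 1 / 2| := div_nonneg hC ha.le
  calc ‖g a fun i => w (Fin.castAdd 2 i)‖ * ‖g b fun j => w (Fin.natAdd 2 j)‖ *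
        ‖g c (fun i => z i + s i) - g c (fun i => z' i + s i)‖
      ≤ C / |(a : ℝ) + 1 / 2| * (C / |(b : ℝ) + 1 / 2|) * (K / |(c : ℝ) + 1 / 2| * ∑ i, torusAbs (z i - z' i)) :=
        mul_le_mul (mul_le_mul (hg_bdd a _) (hg_bdd b _) (norm_nonneg _) hCa) hmod' (norm_nonneg _) (mul_nonneg hCa (div_nonneg hC hb.le))
    _ = K * C ^ 2 * (|(a : ℝ) + 1 / 2| * |(b : ℝ) + 1 / 2| * |(c : ℝ) + 1 / 2|)⁻¹ * ∑ i, torusAbs (z i - z' i) := by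
        field_simp

/-- **Size of the two-loop integrand**: `‖G_z(w)‖ ≤ C³·(|a+½||b+½||c+½|)⁻¹`. -/
theorem klsr_integrand_norm_le (hg_bdd : ∀ (a : ℤ) (x : Fin 2 → ℝ), ‖g a x‖ ≤ C / |(a : ℝ) + 1 / 2|)
    (a b c : ℤ) (z : Fin 2 → ℝ) (w : Fin (2 + 2) → ℝ) :
    ‖g a (fun i => w (Fin.castAdd 2 i)) * g b (fun j => w (Fin.natAdd 2 j)) *
        g c (fun i => z i + w (Fin.natAdd 2 i) - w (Fin.castAdd 2 i))‖ ≤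
      C ^ 3 * (|(a : ℝ) + 1 / 2| * |(b : ℝ) + 1 / 2| * |(c : ℝ) + 1 / 2|)⁻¹ := by
  have ha := klsf_abs_add_half_pos a
  have hb := klsf_abs_add_half_pos b
  have hc := klsf_abs_add_half_pos c
  calc _ ≤ C / |(a : ℝ) + 1 / 2| * (C / |(b : ℝ) + 1 / 2|) * (C / |(c : ℝ) + 1 / 2|) :=
        klsr_norm_mul3_le (hg_bdd a _) (hg_bdd b _) (hg_bdd c _)
    _ = C ^ 3 * (|(a : ℝ) + 1 / 2| * |(b : ℝ) + 1 / 2| * |(c : ℝ) + 1 / 2|)⁻¹ := by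
        field_simp

end Integrand

/-! ## §3 One kept term = one momentum average over `(ℤ/L)⁴`; its size and its two-volume rate -/

section Term

variable {g : ℤ → (Fin 2 → ℝ) → ℂ} {C K : ℝ}

/-- **The kept term is ONE momentum average over `(ℤ/L)⁴` of the `L`-independent integrand** (exact torus conservation at the second
vertex, `apply_latticeMomentum_add_sub`, then `momentumAverage_momentumAverage_eq`); the unkept term is `0`. -/
theorem klsr_klSunsetTerm_eq_ite {L M : ℕ} [NeZero L] (β : ℝ)
    (hg_per : ∀ (a : ℤ) (x : Fin 2 → ℝ) (m : Fin 2 → ℤ), g a (fun i => x i + 2 * π * (m i : ℝ)) = g a x)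
    (ab : ℤ × ℤ) (ω : MatsubaraIdx M) (k : TorusSite 2 L) (σ : Fin 2) {n : ℤ} (hn : matsubaraInt M ω = n) :
    klSunsetTerm L M β g ab (ω, k) σ =
      if ab.1 ∈ Finset.Icc (-(M : ℤ)) ((M : ℤ) - 1) ∧ ab.2 ∈ Finset.Icc (-(M : ℤ)) ((M : ℤ) - 1) ∧
          n + ab.2 - ab.1 ∈ Finset.Icc (-(M : ℤ)) ((M : ℤ) - 1) then
        ((β ^ 2)⁻¹ : ℝ) • (((L ^ (2 + 2) : ℕ) : ℝ)⁻¹ • ∑ r : TorusSite (2 + 2) L,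
          g ab.1 (fun i => latticeMomentum L r (Fin.castAdd 2 i)) * g ab.2 (fun j => latticeMomentum L r (Fin.natAdd 2 j)) *
            g (n + ab.2 - ab.1) (fun i => latticeMomentum L k i + latticeMomentum L r (Fin.natAdd 2 i) -
              latticeMomentum L r (Fin.castAdd 2 i)))
      else 0 := by
  unfold klSunsetTerm
  dsimp only
  rw [hn]
  by_cases h : ab.1 ∈ Finset.Icc (-(M : ℤ)) ((M : ℤ) - 1) ∧ ab.2 ∈ Finset.Icc (-(M : ℤ)) ((M : ℤ) - 1) ∧
      n + ab.2 - ab.1 ∈ Finset.Icc (-(M : ℤ)) ((M : ℤ) - 1)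
  · rw [if_pos h, if_pos h]
    congr 1
    have hthird : ∀ p q : TorusSite 2 L, g (n + ab.2 - ab.1) (latticeMomentum L (k + q - p)) =
        g (n + ab.2 - ab.1) (fun i => latticeMomentum L k i + latticeMomentum L q i - latticeMomentum L p i) :=
      fun p q => apply_latticeMomentum_add_sub (hg_per (n + ab.2 - ab.1)) k q p
    simp_rw [hthird]
    exact momentumAverage_momentumAverage_eq (L := L)
      (fun x y => g ab.1 x * g ab.2 y * g (n + ab.2 - ab.1) (fun i => latticeMomentum L k i + y i - x i))
  · rw [if_neg h, if_neg h]

/-- **Size of a term value**: `‖β⁻² · avg_r G_z(p_r)‖ ≤ β⁻² C³ · (|a+½||b+½||c+½|)⁻¹`. -/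
theorem klsr_value_norm_le {L : ℕ} [NeZero L] {β : ℝ} (hβ : 0 < β) (hC : 0 ≤ C)
    (hg_bdd : ∀ (a : ℤ) (x : Fin 2 → ℝ), ‖g a x‖ ≤ C / |(a : ℝ) + 1 / 2|)
    (a b c : ℤ) (z : Fin 2 → ℝ) :
    ‖((β ^ 2)⁻¹ : ℝ) • (((L ^ (2 + 2) : ℕ) : ℝ)⁻¹ • ∑ r : TorusSite (2 + 2) L,
        g a (fun i => latticeMomentum L r (Fin.castAdd 2 i)) * g b (fun j => latticeMomentum L r (Fin.natAdd 2 j)) *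
          g c (fun i => z i + latticeMomentum L r (Fin.natAdd 2 i) - latticeMomentum L r (Fin.castAdd 2 i)))‖ ≤
      (β ^ 2)⁻¹ * C ^ 3 * (|(a : ℝ) + 1 / 2| * |(b : ℝ) + 1 / 2| * |(c : ℝ) + 1 / 2|)⁻¹ := by
  rw [norm_smul, norm_inv, norm_pow, Real.norm_of_nonneg hβ.le, mul_assoc]
  refine mul_le_mul_of_nonneg_left ?_ (by positivity)
  have hC3 : 0 ≤ C ^ 3 := by positivity
  exact norm_momentumAverage_le fun r => klsr_integrand_norm_le hg_bdd a b c z _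

/-- **Two-volume rate of a term value** (the Riemann-sum step): for `L ≤ L′` and external momenta `z`, `z′`,
`‖β⁻² avg_{(ℤ/L)⁴} G_z − β⁻² avg_{(ℤ/L′)⁴} G_{z′}‖ ≤ β⁻² · (16π K C²/L + K C² · Σ_i |z_i − z′_i|_𝕋) · (|a+½||b+½||c+½|)⁻¹`
(`norm_momentumAverage_sub_momentumAverage_le` in dimension `4` with the Lipschitz modulus `4KC²·w` and the torus modulus as `δ`). -/
theorem klsr_value_sub_value_le {L L' : ℕ} [NeZero L] [NeZero L'] (hLL' : L ≤ L') {β : ℝ} (hβ : 0 < β) (hC : 0 ≤ C) (hK : 0 ≤ K)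
    (hg_per : ∀ (a : ℤ) (x : Fin 2 → ℝ) (m : Fin 2 → ℤ), g a (fun i => x i + 2 * π * (m i : ℝ)) = g a x)
    (hg_bdd : ∀ (a : ℤ) (x : Fin 2 → ℝ), ‖g a x‖ ≤ C / |(a : ℝ) + 1 / 2|)
    (hg_lip : ∀ (a : ℤ) (x y : Fin 2 → ℝ), ‖g a x - g a y‖ ≤ K / |(a : ℝ) + 1 / 2| * ‖x - y‖)
    (a b c : ℤ) (z z' : Fin 2 → ℝ) :
    ‖((β ^ 2)⁻¹ : ℝ) • (((L ^ (2 + 2) : ℕ) : ℝ)⁻¹ • ∑ r : TorusSite (2 + 2) L,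
          g a (fun i => latticeMomentum L r (Fin.castAdd 2 i)) * g b (fun j => latticeMomentum L r (Fin.natAdd 2 j)) *
            g c (fun i => z i + latticeMomentum L r (Fin.natAdd 2 i) - latticeMomentum L r (Fin.castAdd 2 i))) -
        ((β ^ 2)⁻¹ : ℝ) • (((L' ^ (2 + 2) : ℕ) : ℝ)⁻¹ • ∑ r : TorusSite (2 + 2) L',
          g a (fun i => latticeMomentum L' r (Fin.castAdd 2 i)) * g b (fun j => latticeMomentum L' r (Fin.natAdd 2 j)) *
            g c (fun i => z' i + latticeMomentum L' r (Fin.natAdd 2 i) - latticeMomentum L' r (Fin.castAdd 2 i)))‖ ≤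
      (β ^ 2)⁻¹ * ((16 * π * K * C ^ 2 / L + K * C ^ 2 * ∑ i, torusAbs (z i - z' i)) *
        (|(a : ℝ) + 1 / 2| * |(b : ℝ) + 1 / 2| * |(c : ℝ) + 1 / 2|)⁻¹) := by
  have ha := klsf_abs_add_half_pos a
  have hb := klsf_abs_add_half_pos b
  have hc := klsf_abs_add_half_pos c
  set wgt : ℝ := (|(a : ℝ) + 1 / 2| * |(b : ℝ) + 1 / 2| * |(c : ℝ) + 1 / 2|)⁻¹ with hwgt
  have hwgt0 : 0 ≤ wgt := by positivity
  -- the two integrands as functions on `[0,2π]⁴`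
  set G : (Fin (2 + 2) → ℝ) → ℂ := fun w => g a (fun i => w (Fin.castAdd 2 i)) * g b (fun j => w (Fin.natAdd 2 j)) *
    g c (fun i => z i + w (Fin.natAdd 2 i) - w (Fin.castAdd 2 i)) with hG
  set G' : (Fin (2 + 2) → ℝ) → ℂ := fun w => g a (fun i => w (Fin.castAdd 2 i)) * g b (fun j => w (Fin.natAdd 2 j)) *
    g c (fun i => z' i + w (Fin.natAdd 2 i) - w (Fin.castAdd 2 i)) with hG'
  have hLip0 : 0 ≤ 4 * K * C ^ 2 * wgt := by positivity
  set Kn : ℝ≥0 := ⟨4 * K * C ^ 2 * wgt, hLip0⟩ with hKn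
  have hKn_coe : (Kn : ℝ) = 4 * K * C ^ 2 * wgt := rfl
  have hGlip : LipschitzWith Kn G := by
    refine LipschitzWith.of_dist_le_mul fun w w' => ?_
    rw [dist_eq_norm, dist_eq_norm, hKn_coe]
    exact klsr_integrand_sub_le hC hK hg_bdd hg_lip a b c z w w'
  have hG'lip : LipschitzWith Kn G' := by
    refine LipschitzWith.of_dist_le_mul fun w w' => ?_
    rw [dist_eq_norm, dist_eq_norm, hKn_coe]
    exact klsr_integrand_sub_le hC hK hg_bdd hg_lip a b c z' w w'
  have hδ : ∀ q ∈ Set.pi Set.univ (fun _ : Fin (2 + 2) => Set.Icc (0 : ℝ) (2 * π)),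
      ‖G q - G' q‖ ≤ K * C ^ 2 * wgt * ∑ i, torusAbs (z i - z' i) := fun q _ =>
    klsr_integrand_sub_le_tmod hC hK hg_per hg_bdd hg_lip a b c z z' q
  have htwo := norm_momentumAverage_sub_momentumAverage_le (L := L) (L' := L') (d := 2 + 2)
    hGlip.lipschitzOnWith hG'lip.lipschitzOnWith hδ
  rw [hKn_coe] at htwo
  -- the prefactor `β⁻²`
  rw [← smul_sub, norm_smul, norm_inv, norm_pow, Real.norm_of_nonneg hβ.le]
  refine mul_le_mul_of_nonneg_left ?_ (by positivity)
  have hL : (0 : ℝ) < L := by exact_mod_cast Nat.pos_of_ne_zero (NeZero.ne L)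
  have hL' : (0 : ℝ) < L' := by exact_mod_cast Nat.pos_of_ne_zero (NeZero.ne L')
  have hLL'r : (L : ℝ) ≤ L' := by exact_mod_cast hLL'
  have hmono : 2 * π * (4 * K * C ^ 2 * wgt) / L' ≤ 2 * π * (4 * K * C ^ 2 * wgt) / L :=
    div_le_div_of_nonneg_left (by positivity) hL hLL'r
  calc ‖(((L ^ (2 + 2) : ℕ) : ℝ)⁻¹ • ∑ r : TorusSite (2 + 2) L, G (latticeMomentum L r)) -
        ((L' ^ (2 + 2) : ℕ) : ℝ)⁻¹ • ∑ r : TorusSite (2 + 2) L', G' (latticeMomentum L' r)‖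
      ≤ 2 * π * (4 * K * C ^ 2 * wgt) / L + 2 * π * (4 * K * C ^ 2 * wgt) / L' +
          K * C ^ 2 * wgt * ∑ i, torusAbs (z i - z' i) := htwo
    _ ≤ 2 * π * (4 * K * C ^ 2 * wgt) / L + 2 * π * (4 * K * C ^ 2 * wgt) / L +
          K * C ^ 2 * wgt * ∑ i, torusAbs (z i - z' i) := by gcongr
    _ = (16 * π * K * C ^ 2 / L + K * C ^ 2 * ∑ i, torusAbs (z i - z' i)) * wgt := by
        field_simp
        ring

end Term

end Summit.HubbardSuperconductivity.HubbardSuperconductivity.Theorems.KLRegimeSplit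

end
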